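import Summits.ResolutionOfSingularities.ResolutionOfSingularities.Theorems.FrobeniusClosingSteerCurveEscapeResidueTower
import Summits.ResolutionOfSingularities.ResolutionOfSingularities.Theorems.FrobeniusClosingSteerCurveEscapeResidueImage
import Summits.ResolutionOfSingularities.ResolutionOfSingularities.Theorems.SoloInformedRealisation
import Summits.ResolutionOfSingularities.ResolutionOfSingularities.Theorems.RisoStrataRisoCurvesLoc
import Literature.AlgebraicGeometry.Resolution.QuadraticSequenceDimOneExistence
import HarnessLib

/-!
# Crux `Steer` (stmt-ResolutionOfSingularities-16345), chain W4.1, σ-residual SUPPORT: **CurveEscape for curves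
# with one-dimensional residue ring of finite normalisation — the γ-bridge** (helper γ, part 6; Theses-free,
# def-free)

OURS (campaign `res-hironaka`, rung L ★L-G4, slot W4.1; a statement about the route's own objects — sequences of
quadratic transforms of local rings along a valuation ring (`Resolution.IsQuadraticTransformAlong`); it replaces the
role of no printed item and is NOT a statement of the manuscript under review [claim: Hironaka2017, status:
under-review]; AI review is weaker than expert review). res-L0-w41-plan-1 RULING 14 (14e) (HOME/STATUS
2026-08-27T08:16:00Z): «res-type-038 OFFER AMENDED 08:09:11Z (γ bridge `curveEscape_of_finite_integralClosure`, S in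
tree by name — `exists_sequence_eq_valuationSubring` / `exists_quadraticSeq_eq_valuationSubring`, no Literature
fact): GO as free hand counted 0». Serves res-L0-w41-idea-3's card `samuel-genealogy` v2 («G2 = `curveEscape` +
support S: the strict transforms of a followed NON-regular curve become regular after finitely many point steps»).

## Statement (`curveEscape_of_finite_integralClosure`)

As `curveEscape` (part 2, p508406): `O ⊆ K` a valuation ring with ARCHIMEDEAN value group, `R 0 → R 1 → ⋯`
quadratic transforms along `O`, primes `P i ≠ 𝔪_i` with `P (i+1) ∩ R i = P i` for all `i` — but in place of
«`R i ⧸ P i` regular of dimension one for every `i`» ONLY: `P 0 ≠ ⊥`, and the residue ring `R 0 ⧸ P 0` of the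
followed curve AT THE START is Noetherian of Krull dimension `≤ 1` with module-finite normalisation (integral
closure in a fraction field; e.g. excellent, or essentially of finite type over a field by E. Noether). Conclusion:
`False` — no such curve is followed for ever, regular or not.

## Proof (assembling parts 3–5 and the tree)

KEY REMARK 2′ (part 4) makes `O` dominate `R 0`, hence every `R i`; all `R i` lie in the common local ring
`B = (R 0)_{P 0}` with centre `P i` (part 4), so the residue rings `R i ⧸ P i` are the images `D i` of `R i` in
the residue field `κ` of `B` (`RingHom.quotientKerEquivRange`); by part 5 `D 0 → D 1 → ⋯` is a dominated chain of
quadratic transforms with finitely generated maximal ideals, hence (Chevalley on the union,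
`Theorems.exists_valuationSubring_dominates_chain`; `IsQuadraticTransform.along`) a quadratic sequence along a
valuation ring `W` of `κ` dominating every `D i`; `κ = Frac (D 0)` and `D 0 ≅ R 0 ⧸ P 0` is a one-dimensional
Noetherian local domain whose normalisation `N` is finite (hypothesis) and Dedekind (Krull–Akizuki,
`KrullAkizuki_holds.isDedekindDomain_integralClosure`), `N ⊆ W`, the centre of `W` on `N` is non-zero, so
`N_{𝔪_W ∩ N}` is a discrete valuation ring and equals `W` (`Theorems.toSubring_eq_of_dvr_subring`); by
Herrmann–Ikeda–Orbanz (30.2) (`Resolution.exists_sequence_eq_valuationSubring`) some `D i₀ = W`, a discrete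
valuation ring — regular of dimension one — and `curveEscape_seed` (part 3, p511686) concludes.

Def-free, sorry-free.
-/

noncomputable section

set_option linter.dupNamespace false

namespace Summit.ResolutionOfSingularities.ResolutionOfSingularities.Theorems.SwitchingDichotomy.CurveEscape

open IsLocalRing Literature.AlgebraicGeometry.Resolution

universe u

variable {K : Type u} [Field K]

/-! ## §11 Assembly: the bridge -/

section Assembly

open Literature.RingTheory.DiscreteValuationRing

/-- Integral elements over a subring of a valuation ring lie in the valuation ring. OURS bookkeeping. [folklore] -/
theorem mem_valuationSubring_of_mem_integralClosure {κ : Type*} [Field κ] {A : Type*} [CommRing A] [Algebra A κ]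
    (W : ValuationSubring κ) (hW : ∀ a : A, algebraMap A κ a ∈ W) {z : κ} (hz : z ∈ integralClosure A κ) :
    z ∈ W := by
  let φ : A →+* W := (algebraMap A κ).codRestrict W.toSubring hW
  have hf : (algebraMap W κ).comp φ = algebraMap A κ := RingHom.ext fun _ => rfl
  have hint : IsIntegral W z := by
    obtain ⟨q, hq, hqz⟩ := hz
    refine ⟨q.map φ, hq.map φ, ?_⟩
    rw [Polynomial.eval₂_map, hf]
    exact hqz
  obtain ⟨w, hw⟩ := (IsIntegrallyClosed.isIntegral_iff (R := W) (K := κ)).mp hint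
  rw [← hw]
  exact w.2

/-- **The γ-bridge: no curve with one-dimensional residue ring of finite normalisation is followed for ever in
rank one.** Along a sequence of quadratic transforms along a valuation ring `O` with ARCHIMEDEAN value group, primes
`P i ≠ 𝔪_i` with `P (i+1) ∩ R i = P i` for all `i` and `P 0 ≠ ⊥` cannot exist as soon as the residue ring
`R 0 ⧸ P 0` of the followed curve at the start is a Noetherian local domain of dimension `≤ 1` whose normalisation
(integral closure in any fraction field) is module-finite — e.g. `R 0 ⧸ P 0` excellent, or essentially of finite
type over a field (E. Noether). REGULARITY IS NOT ASSUMED at any stage. Proof: KEY REMARK 2′ makes `O` dominate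
`R 0`; all `R i` lie in the common local ring `B = (R 0)_{P 0}` with centre `P i` (part 4), so the residue rings
`R i ⧸ P i` are the images `D i` of `R i` in the residue field `κ` of `B`; `D 0 → D 1 → ⋯` is a dominated chain of
quadratic transforms (`isQuadraticTransform_range`) along any valuation ring `W` of `κ` dominating its union
(Chevalley, `exists_valuationSubring_dominates_chain`; `IsQuadraticTransform.along`); by Herrmann–Ikeda–Orbanz
(30.2) (`exists_sequence_eq_valuationSubring`, with Krull–Akizuki and the finite normalisation `N`: `W = N_{𝔪_W ∩ N}`
is a discrete valuation ring) some `D i₀ = W` is regular of dimension one; conclude by `curveEscape_seed`. OURS.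
[folklore] -/
theorem curveEscape_of_finite_integralClosure :
    ∀ (K : Type) [Field K] (O : ValuationSubring K),
      (∀ x y : K, y ≠ 0 → O.valuation x < 1 → ∃ n : ℕ, O.valuation x ^ n < O.valuation y) →
      ∀ (R : ℕ → Subring K) (hq : ∀ i, IsQuadraticTransformAlong O (R i) (R (i + 1)))
        [∀ i, IsLocalRing (R i)] (P : (i : ℕ) → Ideal (R i)) [∀ i, (P i).IsPrime],
        (∀ i, P i ≠ maximalIdeal (R i)) →
        P 0 ≠ ⊥ →
        IsNoetherianRing (R 0 ⧸ P 0) → ringKrullDim (R 0 ⧸ P 0) ≤ 1 →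
        (∀ (L : Type) [Field L] [Algebra (R 0 ⧸ P 0) L] [IsFractionRing (R 0 ⧸ P 0) L],
          Module.Finite (R 0 ⧸ P 0) (integralClosure (R 0 ⧸ P 0) L)) →
        (∀ i, (P (i + 1)).comap (Subring.inclusion (hq i).le) = P i) →
        False := by
  intro K _ O hArch R hq _ P _ hP𝔪 hP0 hnoeth hdim hfin hc
  classical
  choose _hloc x hx𝔪 hx0 _hxmax hR using fun i => (hq i).exists_eq_locAtCentre
  -- §8: `O` dominates `R 0`, hence every `R i`
  haveI : Ring.KrullDimLE 1 (R 0 ⧸ P 0) := Ring.krullDimLE_iff.mpr hdim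
  haveI hdim1 : Ring.DimensionLEOne (R 0 ⧸ P 0) :=
    ⟨fun h1 h2 => Ring.krullDimLE_one_iff_of_isPrime_bot.mp inferInstance _ h1 h2⟩
  have h0 : SubringDominates (R 0) O.toSubring :=
    subringDominates_of_dimensionLEOne_quotient (hq 0) (hx0 0) (hR 0) (hP𝔪 0) (hP𝔪 1) (hc 0) hdim1
  have hdom : ∀ i, SubringDominates (R i) O.toSubring := subringDominates_of_base hq h0
  -- §9: the common local ring `B` and its residue field `κ`
  set B : Subring K := (LocalSubring.ofPrime (R 0) (P 0)).toSubring with hBdef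
  have hleB : ∀ i, R i ≤ B := le_ofPrime hq hP𝔪 hc hx0 hR
  haveI h𝔪Bmax : (maximalIdeal B).IsMaximal := IsLocalRing.maximalIdeal.isMaximal B
  letI : Field (B ⧸ maximalIdeal B) := Ideal.Quotient.field (maximalIdeal B)
  -- the residue maps `f i : R i → κ` and their images `D i`
  set f : (i : ℕ) → (R i →+* B ⧸ maximalIdeal B) :=
    fun i => (Ideal.Quotient.mk (maximalIdeal B)).comp (Subring.inclusion (hleB i)) with hfdef
  have hker : ∀ i, RingHom.ker (f i) = P i := by
    intro i
    rw [hfdef, ← RingHom.comap_ker, Ideal.mk_ker]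
    exact comap_maximalIdeal_ofPrime hq hP𝔪 hc hx0 hR i
  have hff : ∀ i (r : R i), f (i + 1) (Subring.inclusion (hq i).le r) = f i r := fun i r => rfl
  set D : ℕ → Subring (B ⧸ maximalIdeal B) := fun i => (f i).range with hDdef
  haveI hDloc : ∀ i, IsLocalRing (D i) := fun i => (LocalSubring.range (f i)).isLocalRing
  -- §10: a dominated chain of quadratic transforms
  have hchain : ∀ i, SubringDominates (D i) (D (i + 1)) := fun i =>
    range_dominates (f i) (f (i + 1)) (hq i).le (hq i).target_le (hdom i) (hff i)
  have hfg : ∀ i, (maximalIdeal (D i)).FG := fun i => by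
    obtain ⟨_, hfgi⟩ := (hq i).fg_maximalIdeal
    exact fg_maximalIdeal_range (f i) hfgi
  have hQT : ∀ i, IsQuadraticTransform (D i) (D (i + 1)) := fun i =>
    isQuadraticTransform_range (f i) (f (i + 1)) (hq i) (hdom i) (hx𝔪 i) (hx0 i) (hR i) (hP𝔪 i) (hc i)
      (hker i) (hff i)
  -- Chevalley: a valuation ring `W` of `κ` dominating every `D i`
  obtain ⟨W, hW⟩ := exists_valuationSubring_dominates_chain D hDloc hchain
  have hstep : ∀ i, IsQuadraticTransformAlong W (D i) (D (i + 1)) := fun i =>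
    (hQT i).along ⟨hDloc i, hfg i⟩ (hW (i + 1))
  -- the residue rings `R i ⧸ P i ≃+* D i`
  have e : ∀ i, (R i ⧸ P i) ≃+* D i := fun i =>
    (Ideal.quotEquivOfEq (hker i).symm).trans (RingHom.quotientKerEquivRange (f i))
  haveI : IsNoetherianRing (R 0 ⧸ P 0) := hnoeth
  haveI : IsNoetherianRing (D 0) := isNoetherianRing_of_ringEquiv (R 0 ⧸ P 0) (e 0)
  haveI : Ring.KrullDimLE 1 (D 0) := by
    refine Ring.krullDimLE_iff.mpr ?_
    rw [← ringKrullDim_eq_of_ringEquiv (e 0)]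
    exact hdim
  -- `κ = Frac (D 0)`: every element of `κ` is `f 0 a / f 0 s`
  have hmemker : ∀ i (r : R i), f i r = 0 → r ∈ P i := fun i r hr => by
    have h1 : r ∈ RingHom.ker (f i) := RingHom.mem_ker.mpr hr
    rwa [hker i] at h1
  have hfracD : ∀ z : B ⧸ maximalIdeal B, ∃ a ∈ D 0, ∃ b ∈ D 0, b ≠ 0 ∧ z = a / b := by
    intro z
    obtain ⟨b, rfl⟩ := Ideal.Quotient.mk_surjective z
    obtain ⟨a, s, hsP, hb⟩ := exists_eq_div_of_mem_ofPrime (R := R) (P := P) b.2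
    have hs0 : f 0 s ≠ 0 := fun e => hsP (hmemker 0 s e)
    have hs0K : ((s : R 0) : K) ≠ 0 := fun e => hsP ((show s = 0 from Subtype.ext e) ▸ (P 0).zero_mem)
    refine ⟨f 0 a, ⟨a, rfl⟩, f 0 s, ⟨s, rfl⟩, hs0, ?_⟩
    rw [eq_div_iff hs0]
    have h1 : b * Subring.inclusion (hleB 0) s = Subring.inclusion (hleB 0) a := by
      apply Subtype.ext
      simp only [Subring.coe_mul, Subring.coe_inclusion]
      rw [hb, div_mul_cancel₀ _ hs0K]
    change Ideal.Quotient.mk _ b * Ideal.Quotient.mk _ (Subring.inclusion (hleB 0) s) =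
      Ideal.Quotient.mk _ (Subring.inclusion (hleB 0) a)
    rw [← map_mul, h1]
  have hof : IsLocalRingOf (D 0) := ⟨hDloc 0, hfracD⟩
  -- the abstract residue ring `A = R 0 ⧸ P 0` inside `κ`, with fraction field `κ`
  have hPle : ∀ a : R 0, a ∈ P 0 → f 0 a = 0 := fun a ha => by
    rw [← RingHom.mem_ker, hker 0]
    exact ha
  letI : Algebra (R 0 ⧸ P 0) (B ⧸ maximalIdeal B) := (Ideal.Quotient.lift (P 0) (f 0) hPle).toAlgebra
  have halg : ∀ r : R 0, algebraMap (R 0 ⧸ P 0) (B ⧸ maximalIdeal B) (Ideal.Quotient.mk (P 0) r) = f 0 r :=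
    fun r => Ideal.Quotient.lift_mk _ _ _
  have hinj : Function.Injective (algebraMap (R 0 ⧸ P 0) (B ⧸ maximalIdeal B)) :=
    (Ideal.injective_lift_iff hPle).mpr (hker 0)
  haveI : FaithfulSMul (R 0 ⧸ P 0) (B ⧸ maximalIdeal B) :=
    (faithfulSMul_iff_algebraMap_injective _ _).mpr hinj
  haveI : IsFractionRing (R 0 ⧸ P 0) (B ⧸ maximalIdeal B) := by
    refine IsFractionRing.of_field _ _ fun z => ?_
    obtain ⟨_, ⟨a, rfl⟩, _, ⟨s, rfl⟩, -, rfl⟩ := hfracD z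
    exact ⟨Ideal.Quotient.mk (P 0) a, Ideal.Quotient.mk (P 0) s, by rw [halg, halg]⟩
  have hrangeA : ∀ q : R 0 ⧸ P 0, algebraMap (R 0 ⧸ P 0) (B ⧸ maximalIdeal B) q ∈ D 0 := by
    intro q
    obtain ⟨r, rfl⟩ := Ideal.Quotient.mk_surjective q
    rw [halg]
    exact ⟨r, rfl⟩
  -- the normalisation `N` of `A`: finite (hypothesis), Dedekind (Krull–Akizuki), inside `W`
  have hA : ¬ IsField (R 0 ⧸ P 0) := fun hF =>
    hP𝔪 0 (IsLocalRing.eq_maximalIdeal (Ideal.Quotient.maximal_of_isField (P 0) hF))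
  haveI hfinκ : Module.Finite (R 0 ⧸ P 0) (integralClosure (R 0 ⧸ P 0) (B ⧸ maximalIdeal B)) := hfin _
  haveI hDed : IsDedekindDomain (integralClosure (R 0 ⧸ P 0) (B ⧸ maximalIdeal B)) :=
    KrullAkizuki_holds.isDedekindDomain_integralClosure hA (B ⧸ maximalIdeal B) (B ⧸ maximalIdeal B)
  set N : Subring (B ⧸ maximalIdeal B) := (integralClosure (R 0 ⧸ P 0) (B ⧸ maximalIdeal B)).toSubring
    with hNdef
  haveI : IsDedekindDomain N := hDed
  have hDN : D 0 ≤ N := by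
    rintro _ ⟨r, rfl⟩
    rw [← halg]
    exact isIntegral_algebraMap
  have hNW : N ≤ W.toSubring := fun z hz =>
    mem_valuationSubring_of_mem_integralClosure W (fun q => (hW 0).1 (hrangeA q)) hz
  -- a non-unit of `R 0` outside `P 0`: its residue is a non-zero element of the centre of `W`
  obtain ⟨m, hm𝔪, hmP⟩ : ∃ m : R 0, m ∈ maximalIdeal (R 0) ∧ m ∉ P 0 := by
    by_contra hcon
    push Not at hcon
    exact hP𝔪 0 (le_antisymm (IsLocalRing.le_maximalIdeal (Ideal.IsPrime.ne_top inferInstance)) hcon)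
  have hm0 : f 0 m ≠ 0 := fun e => hmP (hmemker 0 m e)
  have hmD : (f 0).rangeRestrict m ∈ maximalIdeal (D 0) := (rangeRestrict_mem_maximalIdeal_iff (f 0) m).mpr hm𝔪
  have hmW : W.valuation (f 0 m) < 1 :=
    ((subringDominates_valuationSubring_iff (hW 0).1).mp (hW 0) _).mp hmD
  have hWtop : W ≠ ⊤ := by
    intro hWt
    have hinv : (f 0 m)⁻¹ ∈ W.toSubring := by rw [hWt]; exact ValuationSubring.mem_top _
    have hinvD : (f 0 m)⁻¹ ∈ D 0 := (hW 0).2 _ ⟨m, rfl⟩ hinv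
    have hu : IsUnit ((f 0).rangeRestrict m) := (isUnit_subring_iff_inv_mem _).mpr ⟨hm0, hinvD⟩
    exact (IsLocalRing.mem_maximalIdeal _).mp hmD hu
  -- the centre of `W` on `N` is non-zero, so `N_{𝔪_W ∩ N}` is a discrete valuation ring, equal to `W`
  have h𝔫 : subringCentre N W hNW ≠ ⊥ := by
    intro hbot
    have hmN : f 0 m ∈ N := hDN ⟨m, rfl⟩
    have h1 : (⟨f 0 m, hmN⟩ : N) ∈ subringCentre N W hNW := (mem_subringCentre_iff hNW _).mpr hmW
    rw [hbot, Ideal.mem_bot] at h1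
    exact hm0 (congrArg Subtype.val h1)
  haveI := isLocalization_locAtCentre hNW
  haveI : IsDiscreteValuationRing (locAtCentre N W) :=
    IsLocalization.AtPrime.isDiscreteValuationRing_of_dedekind_domain N h𝔫 (locAtCentre N W)
  have hfracV : ∀ z : B ⧸ maximalIdeal B, ∃ a ∈ locAtCentre N W, ∃ b ∈ locAtCentre N W, b ≠ 0 ∧ z = a / b :=
    fun z => by
      obtain ⟨a, ha, b, hb, hb0, rfl⟩ := hfracD z
      exact ⟨a, le_locAtCentre N W (hDN ha), b, le_locAtCentre N W (hDN hb), hb0, rfl⟩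
  have hWV : W.toSubring = locAtCentre N W :=
    toSubring_eq_of_dvr_subring (locAtCentre N W) hfracV W (locAtCentre_le hNW) hWtop
  -- generators of `N` over `A`, and `N ⊆ (D 0)[S]`
  obtain ⟨s, hs⟩ := Module.Finite.fg_top (R := R 0 ⧸ P 0)
    (M := integralClosure (R 0 ⧸ P 0) (B ⧸ maximalIdeal B))
  have hSN : (↑(s.image fun c : integralClosure (R 0 ⧸ P 0) (B ⧸ maximalIdeal B) =>
      (c : B ⧸ maximalIdeal B)) : Set (B ⧸ maximalIdeal B)) ⊆ N := by
    intro z hz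
    rw [Finset.coe_image] at hz
    obtain ⟨c, -, rfl⟩ := hz
    exact c.2
  have hNS : N ≤ Subring.closure ((D 0 : Set (B ⧸ maximalIdeal B)) ∪
      ↑(s.image fun c : integralClosure (R 0 ⧸ P 0) (B ⧸ maximalIdeal B) => (c : B ⧸ maximalIdeal B))) := by
    have key : ∀ z ∈ Submodule.span (R 0 ⧸ P 0) (s : Set (integralClosure (R 0 ⧸ P 0) (B ⧸ maximalIdeal B))),
        (z : B ⧸ maximalIdeal B) ∈ Subring.closure ((D 0 : Set (B ⧸ maximalIdeal B)) ∪
          ↑(s.image fun c : integralClosure (R 0 ⧸ P 0) (B ⧸ maximalIdeal B) => (c : B ⧸ maximalIdeal B))) := by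
      intro z hz
      induction hz using Submodule.span_induction with
      | mem z hz =>
        refine Subring.subset_closure (Or.inr ?_)
        rw [Finset.coe_image]
        exact ⟨z, hz, rfl⟩
      | zero => exact Subring.zero_mem _
      | add z w _ _ hz hw => exact Subring.add_mem _ hz hw
      | smul a z _ hz =>
        rw [Subalgebra.coe_smul, Algebra.smul_def]
        exact Subring.mul_mem _ (Subring.subset_closure (Or.inl (hrangeA a))) hz
    intro c hc
    have hcmem : (⟨c, hc⟩ : integralClosure (R 0 ⧸ P 0) (B ⧸ maximalIdeal B)) ∈
        Submodule.span (R 0 ⧸ P 0) (s : Set (integralClosure (R 0 ⧸ P 0) (B ⧸ maximalIdeal B))) := by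
      rw [hs]
      exact Submodule.mem_top
    exact key _ hcmem
  -- Herrmann–Ikeda–Orbanz (30.2): the residue sequence reaches `W`
  obtain ⟨c, hcW⟩ := exists_sequence_eq_valuationSubring (A := D) hof (hW 0) hstep hNW _ hSN hNS hWV.le
  -- `D c = W` is a discrete valuation ring: regular of dimension one; transport to `R c ⧸ P c`
  let eW : locAtCentre N W ≃+* D c :=
    { toFun := fun z => ⟨z.1, hcW.ge (hWV.ge z.2)⟩
      invFun := fun z => ⟨z.1, hWV.le (hcW.le z.2)⟩
      left_inv := fun _ => rfl
      right_inv := fun _ => rfl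
      map_mul' := fun _ _ => rfl
      map_add' := fun _ _ => rfl }
  haveI : IsDiscreteValuationRing (D c) :=
    IsDiscreteValuationRing.RingEquivClass.isDiscreteValuationRing (A := locAtCentre N W) (B := D c) eW
  haveI hregD : IsRegularLocalRing (D c) := inferInstance
  have hdimD : ringKrullDim (D c) = 1 :=
    IsPrincipalIdealRing.ringKrullDim_eq_one _ (IsDiscreteValuationRing.not_isField _)
  have hreg : IsRegularLocalRing (R c ⧸ P c) := IsRegularLocalRing.of_ringEquiv (e c).symm
  have hdimc : ringKrullDim (R c ⧸ P c) = 1 := by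
    rw [ringKrullDim_eq_of_ringEquiv (e c)]
    exact hdimD
  exact curveEscape_seed K O hArch R hq P hP𝔪 hP0 ⟨c, hreg, hdimc⟩ hc

end Assembly

end Summit.ResolutionOfSingularities.ResolutionOfSingularities.Theorems.SwitchingDichotomy.CurveEscape

end
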